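import Literature.Probability.RandomPlanarGeometry.RestrictionDensityLoewner
import Literature.Probability.RandomPlanarGeometry.ArcHullSlits
import Mathlib.MeasureTheory.Integral.IntervalIntegral.FundThmCalculus
import HarnessLib

/-!
# From Loewner's equation along the boundary arc to the tree's Loewner chain

G. F. Lawler, O. Schramm, W. Werner, *Conformal restriction: the chordal case*, J. Amer. Math.
Soc. **16** (2003), proof of Lemma 3.5 (arXiv p. 13): for the smooth hull `E_δ` bounded by the
simple path `β : [0, s] → ℍ̄`, "parametrized by half-plane capacity … `Φ_t := Φ_{β[0,t]}` …
`Ũ_t := Φ_t(β(t))` … By the chordal version of Loewner's theorem … `∂_t Φ_t(z) =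
2/(Φ_t(z) - Ũ_t) + 2/Ũ_t` (3.4) … `Φ_s = Φ_{E_δ}`". This file is the ASSEMBLY half of the proof
of the named fact `IsArcHull.exists_loewner_chain` (`RestrictionDensityLoewner`): it isolates, as
the predicate `IsArcLoewnerFlow A γ E a U`, the analytic content of Loewner's slit theorem along
the boundary arc `γ` of an arc hull `A` (G. F. Lawler, *Conformally Invariant Processes in the
Plane* (2005), Lemma 4.2, Prop. 4.4, Remark 4.5, in the normalized form (3.4) of [LSW]) —

* the restriction maps `E u` of the slits `γ[0, u]` (`0 < u < 1`) and of `A` itself (`u = 1`),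
* the half-plane capacity clock `a` (continuous, strictly increasing, `a 0 = 0`),
* the image `U u = E_u(γ u)` of the tip (continuous, positive, `U 0 = γ 0`),
* the comparison `im E_1 ≤ im E_u` off `A`, and
* **Loewner's equation with respect to the clock**:
  `(E_v z - E_u z)/(a v - a u) → 1/(E_u z - U_u) + 1/U_u` as `v → u`,

and PROVES from it the conclusion of `IsArcHull.exists_loewner_chain`
(`IsArcLoewnerFlow.exists_chain`): reparametrizing by `τ = a/2` (Remark 4.5), removing the
normalization at `0` by the time shift `c(τ) = ∫₀^τ 2/Ũ` (so that `g_τ = Φ_τ - c(τ)` solves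
`ġ = 2/(g - W)` with `W = Ũ - c`, the tree's `Loewner.IsSolution`), and identifying the tree's
ODE-defined hulls `Loewner.hull W τ` with the slits `γ(0, σ τ]` for `τ < S` and with `A ∩ ℍ` at
the terminal time `S = a(1)/2` WITHOUT any boundary limits: the Loewner map `g_τ` of the tree is
injective on its domain `{T_z > τ}` (`Loewner.injOn_map`), this domain contains `ℍ ∖ γ[0, σ τ]`
(resp. `ℍ ∖ A`), on which `g_τ = Φ_τ - c(τ)` is already ONTO `ℍ`; hence the domain is exactly
that set (`Loewner.domain_eq_of_surjOn`), i.e. the enclosed region is swallowed exactly at `S`.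

The analytic half (the construction of such `E, a, U` from the length–area modulus of continuity
and the expansion of `g_A` at `∞`) is kept separate.

## References

* [LSW] proof of Lemma 3.5, p. 13 [LawlerSchrammWerner2003Restriction].
* G. F. Lawler (2005), §4.1: Lemma 4.2, Lemma 4.3, Prop. 4.4, Remark 4.5, Thm. 4.6 [Lawler2005].
-/

noncomputable section

open Set Filter Metric Complex Function
open _root_.Topology
open UpperHalfPlane (upperHalfPlaneSet isOpen_upperHalfPlaneSet)
open scoped NNReal

namespace Literature.Probability.RandomPlanarGeometry

/-! ### Inverting a capacity clock -/

section Clock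

variable {a : ℝ → ℝ} (hac : ContinuousOn a (Icc 0 1)) (ham : StrictMonoOn a (Icc 0 1)) (ha0 : a 0 = 0)

/-- The inverse `σ₀ : [0, a 1] → [0, 1]` of a clock `a` (continuous, strictly increasing on
`[0, 1]`, `a 0 = 0`), extended by clamping the argument to `[0, a 1]`. [folklore] -/
def clockInv (a : ℝ → ℝ) (y : ℝ) : ℝ := invFunOn a (Icc 0 1) (max 0 (min y (a 1)))

omit hac ham ha0 in
/-- The clamp lands in `[0, a 1]` when `0 ≤ a 1`. [folklore] -/
theorem clamp_mem (h1 : 0 ≤ a 1) (y : ℝ) : max 0 (min y (a 1)) ∈ Icc 0 (a 1) :=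
  ⟨le_max_left _ _, max_le h1 (min_le_right _ _)⟩

omit hac ham ha0 in
/-- On `[0, a 1]` the clamp is the identity. [folklore] -/
theorem clamp_eq {y : ℝ} (hy : y ∈ Icc 0 (a 1)) : max 0 (min y (a 1)) = y := by
  rw [min_eq_left hy.2, max_eq_right hy.1]

include hac ham ha0

omit hac in
/-- `0 ≤ a 1`. [folklore] -/
theorem clock_one_nonneg : 0 ≤ a 1 := by
  rw [← ha0]; exact ham.monotoneOn (left_mem_Icc.2 zero_le_one) (right_mem_Icc.2 zero_le_one) zero_le_one

omit ham in
/-- Every `y ∈ [0, a 1]` is a clock value `a u`, `u ∈ [0, 1]`. [folklore] -/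
theorem exists_clock_eq {y : ℝ} (hy : y ∈ Icc 0 (a 1)) : ∃ u ∈ Icc (0 : ℝ) 1, a u = y := by
  have := intermediate_value_Icc zero_le_one hac
  rw [ha0] at this
  exact this hy

/-- `σ₀ y ∈ [0, 1]`. [folklore] -/
theorem clockInv_mem (y : ℝ) : clockInv a y ∈ Icc (0 : ℝ) 1 :=
  invFunOn_mem (exists_clock_eq hac ha0 (clamp_mem (clock_one_nonneg ham ha0) y))

/-- `a (σ₀ y) = y` for `y ∈ [0, a 1]`. [folklore] -/
theorem clock_clockInv {y : ℝ} (hy : y ∈ Icc 0 (a 1)) : a (clockInv a y) = y := by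
  rw [clockInv, invFunOn_eq (exists_clock_eq hac ha0 (clamp_mem (clock_one_nonneg ham ha0) y)),
    clamp_eq hy]

omit hac in
/-- `σ₀ (a u) = u` for `u ∈ [0, 1]`. [folklore] -/
theorem clockInv_clock {u : ℝ} (hu : u ∈ Icc (0 : ℝ) 1) : clockInv a (a u) = u := by
  have hau : a u ∈ Icc 0 (a 1) := by
    constructor
    · rw [← ha0]; exact ham.monotoneOn (left_mem_Icc.2 zero_le_one) hu hu.1
    · exact ham.monotoneOn hu (right_mem_Icc.2 zero_le_one) hu.2
  rw [clockInv, clamp_eq hau]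
  exact ham.injOn.leftInvOn_invFunOn hu

omit hac in
/-- `σ₀ 0 = 0`. [folklore] -/
theorem clockInv_zero : clockInv a 0 = 0 := by
  have := clockInv_clock ham ha0 (left_mem_Icc.2 (zero_le_one (α := ℝ)))
  rwa [ha0] at this

omit hac in
/-- `σ₀ (a 1) = 1`. [folklore] -/
theorem clockInv_clock_one : clockInv a (a 1) = 1 :=
  clockInv_clock ham ha0 (right_mem_Icc.2 zero_le_one)

/-- `σ₀` is strictly increasing on `[0, a 1]`. [folklore] -/
theorem strictMonoOn_clockInv : StrictMonoOn (clockInv a) (Icc 0 (a 1)) := by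
  intro y hy y' hy' hlt
  by_contra hle
  push Not at hle
  have := ham.monotoneOn (clockInv_mem hac ham ha0 y') (clockInv_mem hac ham ha0 y) hle
  rw [clock_clockInv hac ham ha0 hy, clock_clockInv hac ham ha0 hy'] at this
  exact absurd (hlt.trans_le this) (lt_irrefl _)

/-- `σ₀` is monotone on `[0, a 1]`. [folklore] -/
theorem monotoneOn_clockInv : MonotoneOn (clockInv a) (Icc 0 (a 1)) :=
  (strictMonoOn_clockInv hac ham ha0).monotoneOn

/-- **`σ₀` is continuous on `[0, a 1]`** (a monotone bijection between intervals). [folklore] -/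
theorem continuousOn_clockInv : ContinuousOn (clockInv a) (Icc 0 (a 1)) := by
  have h01 := clock_one_nonneg ham ha0
  set s : Set ℝ := Icc 0 (a 1) with hs
  have hmono := strictMonoOn_clockInv hac ham ha0
  -- values between are attained
  have hbetween_r : ∀ y ∈ s, clockInv a y < 1 → ∀ b > clockInv a y, ∃ c ∈ s, clockInv a c ∈ Ioc (clockInv a y) b := by
    intro y hy hlt b hb
    set u : ℝ := min b 1 with hu
    have hu1 : u ∈ Icc (0 : ℝ) 1 := ⟨le_min ((clockInv_mem hac ham ha0 y).1.trans hb.le) zero_le_one, min_le_right _ _⟩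
    have hyu : clockInv a y < u := lt_min hb hlt
    refine ⟨a u, ⟨?_, ?_⟩, ?_⟩
    · rw [← ha0]; exact ham.monotoneOn (left_mem_Icc.2 zero_le_one) hu1 hu1.1
    · exact ham.monotoneOn hu1 (right_mem_Icc.2 zero_le_one) hu1.2
    · rw [clockInv_clock ham ha0 hu1]
      exact ⟨hyu, min_le_left _ _⟩
  have hbetween_l : ∀ y ∈ s, 0 < clockInv a y → ∀ b < clockInv a y, ∃ c ∈ s, clockInv a c ∈ Ico b (clockInv a y) := by
    intro y hy hlt b hb
    set u : ℝ := max b 0 with hu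
    have hu1 : u ∈ Icc (0 : ℝ) 1 := ⟨le_max_right _ _, max_le (hb.le.trans (clockInv_mem hac ham ha0 y).2) zero_le_one⟩
    have hyu : u < clockInv a y := max_lt hb hlt
    refine ⟨a u, ⟨?_, ?_⟩, ?_⟩
    · rw [← ha0]; exact ham.monotoneOn (left_mem_Icc.2 zero_le_one) hu1 hu1.1
    · exact ham.monotoneOn hu1 (right_mem_Icc.2 zero_le_one) hu1.2
    · rw [clockInv_clock ham ha0 hu1]
      exact ⟨le_max_left _ _, hyu⟩
  -- `σ₀ y < 1` unless `y = a 1`, `0 < σ₀ y` unless `y = 0`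
  have hlt1 : ∀ y ∈ s, y < a 1 → clockInv a y < 1 := by
    intro y hy hya
    have := strictMonoOn_clockInv hac ham ha0 hy (right_mem_Icc.2 h01) hya
    rwa [clockInv_clock_one ham ha0] at this
  have hgt0 : ∀ y ∈ s, 0 < y → 0 < clockInv a y := by
    intro y hy hy0
    have := strictMonoOn_clockInv hac ham ha0 (left_mem_Icc.2 h01) hy hy0
    rwa [clockInv_zero ham ha0] at this
  intro y hy
  rcases hy.1.lt_or_eq with hy0 | hy0
  · rcases hy.2.lt_or_eq with hy1 | hy1
    · -- interior point: two-sided continuity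
      have hsn : s ∈ 𝓝 y := Icc_mem_nhds hy0 hy1
      exact (hmono.continuousAt_of_exists_between hsn
        (hbetween_l y hy (hgt0 y hy hy0)) (hbetween_r y hy (hlt1 y hy hy1))).continuousWithinAt
    · -- right endpoint: continuity from the left
      have hsn : s ∈ 𝓝[≤] y := by
        rw [hy1]; exact Icc_mem_nhdsLE (hy1 ▸ hy0)
      have h := hmono.continuousWithinAt_left_of_exists_between hsn
        (hbetween_l y hy (hgt0 y hy hy0))
      exact h.mono fun z hz ↦ by rw [hy1]; exact hz.2
  · -- left endpoint `y = 0`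
    subst hy0
    rcases h01.lt_or_eq with hpos | hzero
    · have hsn : s ∈ 𝓝[≥] (0 : ℝ) := Icc_mem_nhdsGE hpos
      have h := hmono.continuousWithinAt_right_of_exists_between hsn
        (hbetween_r 0 hy (hlt1 0 hy hpos))
      exact h.mono fun z hz ↦ hz.1
    · -- degenerate interval
      have : s = {0} := by rw [hs, ← hzero, Icc_self]
      rw [this]
      exact continuousWithinAt_singleton

/-- The clamped inverse clock is continuous on `ℝ`. [folklore] -/
theorem continuous_clockInv : Continuous (clockInv a) := by
  have h01 := clock_one_nonneg ham ha0
  have heq : clockInv a = (fun y ↦ invFunOn a (Icc 0 1) y) ∘ (fun y ↦ max 0 (min y (a 1))) := rfl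
  have hc : ContinuousOn (fun y ↦ invFunOn a (Icc 0 1) y) (Icc 0 (a 1)) := by
    refine (continuousOn_clockInv hac ham ha0).congr fun y hy ↦ ?_
    show invFunOn a (Icc 0 1) y = clockInv a y
    rw [clockInv, clamp_eq hy]
  rw [heq]
  exact hc.comp_continuous ((continuous_const.max (continuous_id.min continuous_const)))
    (clamp_mem h01)

end Clock

/-! ### An injectivity principle for the tree's Loewner hulls -/

namespace Loewner

variable {W : ℝ≥0 → ℝ}

/-- **The Loewner domain is the largest set on which `g_t` is a bijection onto `ℍ`**: if
`V ⊆ H_t = {T_z > t} ∩ ℍ` and `g_t(V) ⊇ ℍ`, then `H_t = V` (`g_t` is injective on `H_t` with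
values in `ℍ`, `Loewner.injOn_map`, `Loewner.mapsTo_map`). [folklore] -/
theorem domain_eq_of_surjOn (hW : Continuous W) {t : ℝ≥0} {V : Set ℂ} (hV : V ⊆ domain W t)
    (hsurj : SurjOn (map W t) V upperHalfPlaneSet) : domain W t = V := by
  refine Subset.antisymm (fun z hz ↦ ?_) hV
  obtain ⟨z', hz', heq⟩ := hsurj (mapsTo_map hW t hz)
  have := injOn_map hW t (hV hz') hz heq
  exact this ▸ hz'

/-- … equivalently, `K_t = ℍ ∖ V`. [folklore] -/
theorem hull_eq_of_surjOn (hW : Continuous W) {t : ℝ≥0} {V : Set ℂ} (hV : V ⊆ domain W t)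
    (hsurj : SurjOn (map W t) V upperHalfPlaneSet) : hull W t = upperHalfPlaneSet \ V := by
  rw [← domain_eq_of_surjOn hW hV hsurj, domain, sdiff_sdiff_right_self]
  exact (inter_eq_right.2 (hull_subset W t)).symm

end Loewner

/-! ### The hulls along the arc and the analytic interface -/

/-- **The hulls along the boundary arc**: the slit `γ[0, u]` for `u < 1` and the whole hull `A` at
the terminal parameter `u ≥ 1` ([LSW] p. 13: `β[0, t]`, `t < s`, and `E_δ` at `t = s`).
[cite: LawlerSchrammWerner2003Restriction, proof of Lemma 3.5 (p. 13)] -/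
def arcHullAt (A : Set ℂ) (γ : ℝ → ℂ) (u : ℝ) : Set ℂ := if u < 1 then γ '' Icc 0 u else A

/-- For `u < 1` the hull is the slit. [folklore] -/
theorem arcHullAt_of_lt {A : Set ℂ} {γ : ℝ → ℂ} {u : ℝ} (hu : u < 1) : arcHullAt A γ u = γ '' Icc 0 u :=
  if_pos hu

/-- At `u = 1` the hull is `A`. [folklore] -/
@[simp] theorem arcHullAt_one {A : Set ℂ} {γ : ℝ → ℂ} : arcHullAt A γ 1 = A := if_neg (lt_irrefl _)

/-- **The analytic content of Loewner's slit theorem along the boundary arc of an arc hull**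
(Lawler (2005), Lemma 4.2, Prop. 4.4, Remark 4.5, in the normalized form (3.4) of [LSW] p. 13), as
an interface: maps `E u` (bijections `ℍ ∖ H_u → ℍ`, `E 0 = id`; the restriction maps
`Φ_{β[0,u]}`, `Φ_{E_δ}`), a capacity clock `a` (continuous, strictly increasing, `a 0 = 0`; half
the half-plane capacity is the Loewner time), the tip values `U u = Φ_u(γ u)` (continuous,
positive, `U 0 = γ 0`), the comparison `im E_1 ≤ im E_u` off `A`, and **Loewner's equation with
respect to the clock**: for `z` off `H_{u₀}` and `u ≤ u₀`,
`(E_v z - E_u z)/(a v - a u) → 1/(E_u z - U_u) + 1/U_u` as `v → u` within `[0, u₀]`.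
[cite: LawlerSchrammWerner2003Restriction, proof of Lemma 3.5 (p. 13), eq. (3.4)] -/
structure IsArcLoewnerFlow (A : Set ℂ) (γ : ℝ → ℂ) (E : ℝ → ℂ → ℂ) (a U : ℝ → ℝ) : Prop where
  bijOn : ∀ u ∈ Ioc (0 : ℝ) 1, BijOn (E u) (upperHalfPlaneSet \ arcHullAt A γ u) upperHalfPlaneSet
  apply_zero : ∀ z, E 0 z = z
  continuousOn_clock : ContinuousOn a (Icc 0 1)
  strictMonoOn_clock : StrictMonoOn a (Icc 0 1)
  clock_zero : a 0 = 0
  continuousOn_tip : ContinuousOn U (Icc 0 1)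
  tip_pos : ∀ u ∈ Icc (0 : ℝ) 1, 0 < U u
  tip_zero : U 0 = (γ 0).re
  im_le : ∀ u ∈ Icc (0 : ℝ) 1, ∀ z ∈ upperHalfPlaneSet \ A, (E 1 z).im ≤ (E u z).im
  tendsto_slope : ∀ u₀ ∈ Ioc (0 : ℝ) 1, ∀ z ∈ upperHalfPlaneSet \ arcHullAt A γ u₀, ∀ u ∈ Icc 0 u₀,
    Tendsto (fun v ↦ (E v z - E u z) / ((a v - a u : ℝ) : ℂ)) (𝓝[Icc 0 u₀ \ {u}] u)
      (𝓝 (1 / (E u z - U u) + 1 / (U u : ℂ)))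

/-! ### The chain built from a flow: time change, driving function, solutions -/

/-- The curve parameter at Loewner time `τ`: `σ(τ) = a⁻¹(2τ)` (Remark 4.5). [cite: Lawler2005, §4.1 Remark 4.5] -/
def arcParam (a : ℝ → ℝ) (τ : ℝ) : ℝ := clockInv a (2 * τ)

/-- The normalized driving function `Ũ_τ = U (σ τ)` ([LSW] p. 13). [cite: LawlerSchrammWerner2003Restriction, proof of Lemma 3.5 (p. 13)] -/
def arcTip (a U : ℝ → ℝ) (τ : ℝ) : ℝ := U (arcParam a τ)

/-- The time shift `c(τ) = ∫₀^τ 2/Ũ_r dr` removing the normalization at `0`. [folklore] -/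
def arcTimeShift (a U : ℝ → ℝ) (τ : ℝ) : ℝ := ∫ r in (0 : ℝ)..τ, 2 / arcTip a U r

/-- The driving function `W = Ũ - c` on real times. [folklore] -/
def arcDrivingR (a U : ℝ → ℝ) (τ : ℝ) : ℝ := arcTip a U τ - arcTimeShift a U τ

/-- The driving function `W : ℝ≥0 → ℝ` of the chain. [cite: LawlerSchrammWerner2003Restriction, proof of Lemma 3.5 (p. 13), U_t] -/
def arcDriving (a U : ℝ → ℝ) : ℝ≥0 → ℝ := fun t ↦ arcDrivingR a U t

/-- The flow `g_τ(z) = E_{σ τ}(z) - c(τ)` of a point. [folklore] -/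
def arcFlow (E : ℝ → ℂ → ℂ) (a U : ℝ → ℝ) (z : ℂ) (τ : ℝ) : ℂ := E (arcParam a τ) z - (arcTimeShift a U τ : ℂ)

section Assembly

variable {A : Set ℂ} {γ : ℝ → ℂ} {E : ℝ → ℂ → ℂ} {a U : ℝ → ℝ}
  (hA : IsArcHull A) (hγc : ContinuousOn γ (Icc 0 1)) (hγi : InjOn γ (Icc 0 1)) (h0 : (γ 0).im = 0)
  (hH : ∀ t ∈ Ioo (0 : ℝ) 1, 0 < (γ t).im) (hfr : upperHalfPlaneSet ∩ frontier A = γ '' Ioo 0 1)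
  (hF : IsArcLoewnerFlow A γ E a U)

namespace IsArcLoewnerFlow

/-! #### The time change -/

include hF in
/-- `0 < a 1`. [folklore] -/
theorem clock_one_pos : 0 < a 1 := by
  rw [← hF.clock_zero]
  exact hF.strictMonoOn_clock (left_mem_Icc.2 zero_le_one) (right_mem_Icc.2 zero_le_one) zero_lt_one

include hF in
/-- `σ τ ∈ [0, 1]`. [folklore] -/
theorem arcParam_mem (τ : ℝ) : arcParam a τ ∈ Icc (0 : ℝ) 1 :=
  clockInv_mem hF.continuousOn_clock hF.strictMonoOn_clock hF.clock_zero _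

include hF in
/-- `a (σ τ) = 2τ` for `τ ∈ [0, a 1 / 2]`. [folklore] -/
theorem clock_arcParam {τ : ℝ} (hτ : τ ∈ Icc 0 (a 1 / 2)) : a (arcParam a τ) = 2 * τ :=
  clock_clockInv hF.continuousOn_clock hF.strictMonoOn_clock hF.clock_zero ⟨by linarith [hτ.1], by linarith [hτ.2]⟩

include hF in
/-- `σ (a u / 2) = u` for `u ∈ [0, 1]`. [folklore] -/
theorem arcParam_clock {u : ℝ} (hu : u ∈ Icc (0 : ℝ) 1) : arcParam a (a u / 2) = u := by
  rw [arcParam, mul_div_cancel₀ _ two_ne_zero]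
  exact clockInv_clock hF.strictMonoOn_clock hF.clock_zero hu

include hF in
/-- `σ 0 = 0`. [folklore] -/
theorem arcParam_zero : arcParam a 0 = 0 := by
  rw [arcParam, mul_zero]; exact clockInv_zero hF.strictMonoOn_clock hF.clock_zero

include hF in
/-- `σ (a 1 / 2) = 1`. [folklore] -/
theorem arcParam_end : arcParam a (a 1 / 2) = 1 :=
  hF.arcParam_clock (right_mem_Icc.2 zero_le_one)

include hF in
/-- `σ` is continuous. [folklore] -/
theorem continuous_arcParam : Continuous (arcParam a) :=
  (continuous_clockInv hF.continuousOn_clock hF.strictMonoOn_clock hF.clock_zero).comp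
    (continuous_const.mul continuous_id)

include hF in
/-- `σ` is strictly increasing on `[0, a 1 / 2]`. [folklore] -/
theorem strictMonoOn_arcParam : StrictMonoOn (arcParam a) (Icc 0 (a 1 / 2)) := by
  intro τ hτ τ' hτ' hlt
  exact strictMonoOn_clockInv hF.continuousOn_clock hF.strictMonoOn_clock hF.clock_zero
    ⟨by linarith [hτ.1], by linarith [hτ.2]⟩ ⟨by linarith [hτ'.1], by linarith [hτ'.2]⟩ (by linarith)

include hF in
/-- `σ` is monotone on `[0, a 1 / 2]`. [folklore] -/
theorem monotoneOn_arcParam : MonotoneOn (arcParam a) (Icc 0 (a 1 / 2)) :=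
  hF.strictMonoOn_arcParam.monotoneOn

/-! #### The driving function -/

include hF in
/-- `Ũ` is continuous. [folklore] -/
theorem continuous_arcTip : Continuous (arcTip a U) :=
  hF.continuousOn_tip.comp_continuous hF.continuous_arcParam hF.arcParam_mem

include hF in
/-- `Ũ > 0`. [folklore] -/
theorem arcTip_pos (τ : ℝ) : 0 < arcTip a U τ := hF.tip_pos _ (hF.arcParam_mem τ)

include hF in
/-- `2/Ũ` is continuous. [folklore] -/
theorem continuous_two_div_arcTip : Continuous fun r ↦ 2 / arcTip a U r :=
  continuous_const.div hF.continuous_arcTip fun r ↦ (hF.arcTip_pos r).ne'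

include hF in
/-- `c'(τ) = 2/Ũ_τ`. [folklore] -/
theorem hasDerivAt_arcTimeShift (τ : ℝ) : HasDerivAt (arcTimeShift a U) (2 / arcTip a U τ) τ :=
  (hF.continuous_two_div_arcTip.integral_hasStrictDerivAt 0 τ).hasDerivAt

include hF in
/-- `c` is continuous. [folklore] -/
theorem continuous_arcTimeShift : Continuous (arcTimeShift a U) :=
  continuous_iff_continuousAt.2 fun τ ↦ (hF.hasDerivAt_arcTimeShift τ).continuousAt

omit hF in
/-- `c(0) = 0`. [folklore] -/
theorem arcTimeShift_zero : arcTimeShift a U 0 = 0 := intervalIntegral.integral_same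

include hF in
/-- **The driving function `W` is continuous.** [folklore] -/
theorem continuous_arcDriving : Continuous (arcDriving a U) :=
  (hF.continuous_arcTip.sub hF.continuous_arcTimeShift).comp continuous_subtype_val

include hF h0 in
/-- **`W_0 = γ(0)`.** [folklore] -/
theorem arcDriving_zero : ((arcDriving a U 0 : ℝ) : ℂ) = γ 0 := by
  simp only [arcDriving, NNReal.coe_zero, arcDrivingR, arcTip, hF.arcParam_zero, arcTimeShift_zero, sub_zero,
    hF.tip_zero]
  exact Complex.ext (by simp) (by simp [h0])

/-! #### Monotonicity of the hulls along the arc -/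

include hA hγc hfr in
/-- `H_u ⊆ H_v` for `0 ≤ u ≤ v ≤ 1`… in fact for all `u ≤ v` with `v ≤ 1`. [folklore] -/
theorem arcHullAt_mono {u v : ℝ} (huv : u ≤ v) (hv : v ≤ 1) : arcHullAt A γ u ⊆ arcHullAt A γ v := by
  rcases hv.lt_or_eq with hv1 | hv1
  · rw [arcHullAt_of_lt (huv.trans_lt hv1), arcHullAt_of_lt hv1]
    exact image_mono (Icc_subset_Icc_right huv)
  · subst hv1
    rw [arcHullAt_one]
    by_cases hu : u < 1
    · rw [arcHullAt_of_lt hu]; exact hA.slit_subset hγc hfr huv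
    · rw [arcHullAt, if_neg hu]

include hA hγc hfr in
/-- `H_u ⊆ A` for `u ≤ 1`. [folklore] -/
theorem arcHullAt_subset {u : ℝ} (hu : u ≤ 1) : arcHullAt A γ u ⊆ A := by
  have := arcHullAt_mono hA hγc hfr hu le_rfl
  rwa [arcHullAt_one] at this

include hA hγc hfr hF in
/-- `E_u z ∈ ℍ` for `z ∈ ℍ ∖ H_{u₀}`, `0 ≤ u ≤ u₀ ≤ 1`. [folklore] -/
theorem apply_mem {u₀ : ℝ} (hu₀ : u₀ ≤ 1) {z : ℂ} (hz : z ∈ upperHalfPlaneSet \ arcHullAt A γ u₀)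
    {u : ℝ} (hu : u ∈ Icc 0 u₀) : E u z ∈ upperHalfPlaneSet := by
  rcases hu.1.lt_or_eq with hpos | hzero
  · exact (hF.bijOn u ⟨hpos, hu.2.trans hu₀⟩).mapsTo ⟨hz.1, fun h ↦ hz.2 (arcHullAt_mono hA hγc hfr hu.2 hu₀ h)⟩
  · rw [← hzero, hF.apply_zero]; exact hz.1

/-! #### Loewner's equation in Loewner time: the flow solves the tree's ODE -/

include hF in
/-- **`t ↦ E_{σ t} z` has derivative `2/(E_{σ τ} z - Ũ_τ) + 2/Ũ_τ` within `[0, τ₀]`** at every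
`τ ≤ τ₀ = a(u₀)/2`, for `z` off `H_{u₀}` (the clock-derivative of the flow composed with the
time change `σ`, along which `a ∘ σ = 2 ·`). [cite: LawlerSchrammWerner2003Restriction, proof of Lemma 3.5 (p. 13), eq. (3.4)] -/
theorem hasDerivWithinAt_comp_arcParam {u₀ : ℝ} (hu₀ : u₀ ∈ Ioc (0 : ℝ) 1) {z : ℂ}
    (hz : z ∈ upperHalfPlaneSet \ arcHullAt A γ u₀) {τ : ℝ} (hτ : τ ∈ Icc 0 (a u₀ / 2)) :
    HasDerivWithinAt (fun t ↦ E (arcParam a t) z)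
      (2 * (1 / (E (arcParam a τ) z - U (arcParam a τ)) + 1 / (U (arcParam a τ) : ℂ)))
      (Icc 0 (a u₀ / 2)) τ := by
  set τ₀ : ℝ := a u₀ / 2 with hτ₀
  set u : ℝ := arcParam a τ with hu
  have hu₀1 : u₀ ∈ Icc (0 : ℝ) 1 := ⟨hu₀.1.le, hu₀.2⟩
  have hτ₀S : τ₀ ≤ a 1 / 2 := by
    have := hF.strictMonoOn_clock.monotoneOn hu₀1 (right_mem_Icc.2 zero_le_one) hu₀.2
    rw [hτ₀]; linarith
  have hmemS : ∀ t ∈ Icc 0 τ₀, t ∈ Icc 0 (a 1 / 2) := fun t ht ↦ ⟨ht.1, ht.2.trans hτ₀S⟩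
  have hστ₀ : arcParam a τ₀ = u₀ := hF.arcParam_clock hu₀1
  -- `σ` maps `[0, τ₀]` into `[0, u₀]`, injectively
  have hτ₀mem : τ₀ ∈ Icc 0 τ₀ := ⟨hτ.1.trans hτ.2, le_rfl⟩
  have hσmem : ∀ t ∈ Icc 0 τ₀, arcParam a t ∈ Icc 0 u₀ := fun t ht ↦ by
    refine ⟨(hF.arcParam_mem t).1, ?_⟩
    rw [← hστ₀]
    exact hF.monotoneOn_arcParam (hmemS t ht) (hmemS τ₀ hτ₀mem) ht.2
  have humem : u ∈ Icc 0 u₀ := hσmem τ hτ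
  have hmaps : MapsTo (arcParam a) (Icc 0 τ₀ \ {τ}) (Icc 0 u₀ \ {u}) := by
    rintro t ⟨ht, htne⟩
    refine ⟨hσmem t ht, fun heq ↦ htne ?_⟩
    exact hF.strictMonoOn_arcParam.injOn (hmemS t ht) (hmemS τ hτ) heq
  -- the clock-derivative along `σ`
  have hlim := hF.tendsto_slope u₀ hu₀ z hz u humem
  have hσc : Tendsto (arcParam a) (𝓝[Icc 0 τ₀ \ {τ}] τ) (𝓝[Icc 0 u₀ \ {u}] u) :=
    (hF.continuous_arcParam.continuousWithinAt).tendsto_nhdsWithin hmaps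
  have hcomp := (hlim.comp hσc).const_mul (2 : ℂ)
  -- the slope of `t ↦ E (σ t) z` is `2 ·` that expression
  rw [hasDerivWithinAt_iff_tendsto_slope]
  refine hcomp.congr' ?_
  filter_upwards [self_mem_nhdsWithin] with t ht
  obtain ⟨htI, htne⟩ := ht
  have htne' : t ≠ τ := htne
  have hclock : a (arcParam a t) - a u = 2 * t - 2 * τ := by
    rw [hF.clock_arcParam (hmemS t htI), hu, hF.clock_arcParam (hmemS τ hτ)]
  simp only [Function.comp_apply, slope, vsub_eq_sub, hclock]
  rw [real_smul]
  push_cast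
  have h2 : (2 * (t : ℂ) - 2 * τ) = 2 * ((t : ℂ) - τ) := by ring
  have hne : (t : ℂ) - τ ≠ 0 := by
    rw [sub_ne_zero]; exact_mod_cast htne'
  rw [h2]
  field_simp
  rw [hu]

include hA hγc hfr hF in
/-- `g_τ(z) - W_τ = E_{σ τ}(z) - Ũ_τ` has positive imaginary part (for `z` off `H_{u₀}`,
`τ ≤ τ₀`). [folklore] -/
theorem im_arcFlow_sub_pos {u₀ : ℝ} (hu₀ : u₀ ∈ Ioc (0 : ℝ) 1) {z : ℂ}
    (hz : z ∈ upperHalfPlaneSet \ arcHullAt A γ u₀) {τ : ℝ} (hτ : τ ∈ Icc 0 (a u₀ / 2)) :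
    0 < (arcFlow E a U z τ - arcDrivingR a U τ).im := by
  have hden : arcFlow E a U z τ - arcDrivingR a U τ = E (arcParam a τ) z - U (arcParam a τ) := by
    simp only [arcFlow, arcDrivingR, arcTip]; push_cast; ring
  rw [hden, sub_im, ofReal_im, sub_zero]
  have hu₀1 : u₀ ∈ Icc (0 : ℝ) 1 := ⟨hu₀.1.le, hu₀.2⟩
  have hτS : τ ∈ Icc 0 (a 1 / 2) := by
    have := hF.strictMonoOn_clock.monotoneOn hu₀1 (right_mem_Icc.2 zero_le_one) hu₀.2
    exact ⟨hτ.1, hτ.2.trans (by linarith)⟩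
  have hσle : arcParam a τ ≤ u₀ := by
    rw [← hF.arcParam_clock hu₀1]
    have hτ₀S : a u₀ / 2 ∈ Icc 0 (a 1 / 2) := ⟨hτ.1.trans hτ.2, by
      have := hF.strictMonoOn_clock.monotoneOn hu₀1 (right_mem_Icc.2 zero_le_one) hu₀.2; linarith⟩
    exact hF.monotoneOn_arcParam hτS hτ₀S hτ.2
  exact apply_mem hA hγc hfr hF hu₀.2 hz ⟨(hF.arcParam_mem τ).1, hσle⟩

include hA hγc hfr hF in
/-- **The flow `g_t(z) = E_{σ t}(z) - c(t)` solves `ġ = 2/(g - W)` within `[0, τ₀]`.**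
[cite: Lawler2005, §4.1 Prop. 4.4 (with Remark 4.5)] -/
theorem hasDerivWithinAt_arcFlow {u₀ : ℝ} (hu₀ : u₀ ∈ Ioc (0 : ℝ) 1) {z : ℂ}
    (hz : z ∈ upperHalfPlaneSet \ arcHullAt A γ u₀) {τ : ℝ} (hτ : τ ∈ Icc 0 (a u₀ / 2)) :
    HasDerivWithinAt (arcFlow E a U z) (2 / (arcFlow E a U z τ - arcDrivingR a U τ)) (Icc 0 (a u₀ / 2)) τ := by
  have h1 := hasDerivWithinAt_comp_arcParam hF hu₀ hz hτ
  have h2 : HasDerivWithinAt (fun t ↦ (arcTimeShift a U t : ℂ)) (((2 / arcTip a U τ : ℝ) : ℂ)) (Icc 0 (a u₀ / 2)) τ :=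
    ((hF.hasDerivAt_arcTimeShift τ).ofReal_comp).hasDerivWithinAt
  have h3 := h1.sub h2
  have hU : (U (arcParam a τ) : ℂ) ≠ 0 := by exact_mod_cast (hF.tip_pos _ (hF.arcParam_mem τ)).ne'
  have hpos := im_arcFlow_sub_pos hA hγc hfr hF hu₀ hz hτ
  have hden : arcFlow E a U z τ - arcDrivingR a U τ = E (arcParam a τ) z - U (arcParam a τ) := by
    simp only [arcFlow, arcDrivingR, arcTip]; push_cast; ring
  have hEU : E (arcParam a τ) z - U (arcParam a τ) ≠ 0 := by
    intro h; rw [hden, h, zero_im] at hpos; exact lt_irrefl _ hpos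
  have heq : 2 * (1 / (E (arcParam a τ) z - U (arcParam a τ)) + 1 / (U (arcParam a τ) : ℂ)) -
      ((2 / arcTip a U τ : ℝ) : ℂ) = 2 / (arcFlow E a U z τ - arcDrivingR a U τ) := by
    rw [hden]
    simp only [arcTip]
    push_cast
    field_simp
    ring
  have h4 := h3.congr_deriv heq
  exact h4

include hA hγc hfr hF in
/-- **The flow is a solution of the tree's Loewner equation** driven by `W`, started at `z`, with
lifetime `τ₀ = a(u₀)/2`, for every `z ∈ ℍ ∖ H_{u₀}`. [cite: Lawler2005, §4.1 Prop. 4.4 and Thm. 4.6] -/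
theorem isSolution_arcFlow {u₀ : ℝ} (hu₀ : u₀ ∈ Ioc (0 : ℝ) 1) {z : ℂ}
    (hz : z ∈ upperHalfPlaneSet \ arcHullAt A γ u₀) {T : ℝ≥0} (hT : (T : ℝ) = a u₀ / 2) :
    Loewner.IsSolution (arcDriving a U) z (arcFlow E a U z) (T : WithTop ℝ≥0) := by
  refine ⟨?_, fun t ht ↦ ?_, fun t ht htT ↦ ?_⟩
  · simp only [arcFlow, hF.arcParam_zero, hF.apply_zero, arcTimeShift_zero, ofReal_zero, sub_zero]
  · have ht' : 0 ≤ t ∧ t < T := Loewner.mem_timeDomain_coe_iff.1 ht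
    rw [hT] at ht'
    have hder := hasDerivWithinAt_arcFlow hA hγc hfr hF hu₀ hz ⟨ht'.1, ht'.2.le⟩
    have hsub : {s : ℝ | 0 ≤ s ∧ (s.toNNReal : WithTop ℝ≥0) < (T : WithTop ℝ≥0)} ⊆ Icc 0 (a u₀ / 2) := by
      intro s hs
      have hs' := Loewner.mem_timeDomain_coe_iff.1 hs
      rw [hT] at hs'
      exact ⟨hs'.1, hs'.2.le⟩
    refine (hder.mono hsub).congr_deriv ?_
    rw [Loewner.vectorField_apply]
    dsimp only [arcDriving]
    rw [Real.coe_toNNReal _ ht'.1]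
  · have ht' : 0 ≤ t ∧ t < T := Loewner.mem_timeDomain_coe_iff.1 ⟨ht, htT⟩
    rw [hT] at ht'
    have hpos := im_arcFlow_sub_pos hA hγc hfr hF hu₀ hz ⟨ht'.1, ht'.2.le⟩
    intro heq
    dsimp only [arcDriving] at heq
    rw [Real.coe_toNNReal _ ht'.1] at heq
    rw [heq, sub_self, zero_im] at hpos
    exact lt_irrefl _ hpos

/-! #### The points off the hulls flow, and the Loewner map there is the flow -/

include hγi hF in
/-- **Room beyond a slit**: a point of `ℍ` off the slit `γ[0, σ τ]` (`τ < a(1)/2`) is off a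
strictly later hull `H_{u₁}`, `u₁ > σ τ`. [folklore] -/
theorem exists_gt_notMem {τ : ℝ} (hτ : τ ∈ Ico 0 (a 1 / 2)) {z : ℂ}
    (hz : z ∈ upperHalfPlaneSet \ arcHullAt A γ (arcParam a τ)) :
    ∃ u₁ ∈ Ioc (0 : ℝ) 1, arcParam a τ < u₁ ∧ z ∉ arcHullAt A γ u₁ := by
  set u : ℝ := arcParam a τ with hu
  have humem : u ∈ Icc (0 : ℝ) 1 := hF.arcParam_mem τ
  have hu1 : u < 1 := by
    rw [← hF.arcParam_end]
    exact hF.strictMonoOn_arcParam ⟨hτ.1, hτ.2.le⟩ ⟨by linarith [hτ.1, hτ.2], le_rfl⟩ hτ.2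
  have hzH : z ∉ γ '' Icc 0 u := by rw [← arcHullAt_of_lt hu1]; exact hz.2
  by_cases hzA : z ∈ A
  · by_cases hP : ∃ r ∈ Icc (0 : ℝ) 1, γ r = z
    · obtain ⟨r, hr, hrz⟩ := hP
      have hur : u < r := lt_of_not_ge fun hle ↦ hzH ⟨r, ⟨hr.1, hle⟩, hrz⟩
      refine ⟨(u + r) / 2, ⟨by linarith [humem.1], by linarith [hr.2]⟩, by linarith, ?_⟩
      have hlt1 : (u + r) / 2 < 1 := by linarith [hr.2]
      rw [arcHullAt_of_lt hlt1]
      rintro ⟨r', hr', hr'z⟩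
      have : r' = r := hγi ⟨hr'.1, hr'.2.trans hlt1.le⟩ hr (hr'z.trans hrz.symm)
      rw [this] at hr'
      linarith [hr'.2]
    · refine ⟨(u + 1) / 2, ⟨by linarith [humem.1], by linarith⟩, by linarith, ?_⟩
      have hlt1 : (u + 1) / 2 < 1 := by linarith
      rw [arcHullAt_of_lt hlt1]
      rintro ⟨r', hr', hr'z⟩
      exact hP ⟨r', ⟨hr'.1, hr'.2.trans hlt1.le⟩, hr'z⟩
  · exact ⟨1, ⟨zero_lt_one, le_rfl⟩, hu1, by rwa [arcHullAt_one]⟩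

include hA hγc hγi hfr hF in
/-- **Before the terminal time, points off the slit are still flowing and `g_t = E_{σ t} - c(t)`
there.** [cite: Lawler2005, §4.1 Thm. 4.6] -/
theorem lt_swallowingTime_and_map_eq {t : ℝ≥0} (ht : (t : ℝ) < a 1 / 2) {z : ℂ}
    (hz : z ∈ upperHalfPlaneSet \ arcHullAt A γ (arcParam a t)) :
    (t : WithTop ℝ≥0) < Loewner.swallowingTime (arcDriving a U) z ∧
      Loewner.map (arcDriving a U) t z = arcFlow E a U z t := by
  obtain ⟨u₁, hu₁, hlt, hzu₁⟩ := exists_gt_notMem hγi hF ⟨t.coe_nonneg, ht⟩ hz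
  have hu₁1 : u₁ ∈ Icc (0 : ℝ) 1 := ⟨hu₁.1.le, hu₁.2⟩
  have h2t : 2 * (t : ℝ) < a u₁ := by
    have h1 : a (arcParam a t) < a u₁ := hF.strictMonoOn_clock (hF.arcParam_mem t) hu₁1 hlt
    rwa [hF.clock_arcParam ⟨t.coe_nonneg, ht.le⟩] at h1
  have hT₀ : (0 : ℝ) ≤ a u₁ / 2 := by linarith [t.coe_nonneg]
  have hsol := isSolution_arcFlow hA hγc hfr hF hu₁ ⟨hz.1, hzu₁⟩ (T := (a u₁ / 2).toNNReal)
    (Real.coe_toNNReal _ hT₀)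
  have htT : (t : WithTop ℝ≥0) < (((a u₁ / 2).toNNReal : ℝ≥0) : WithTop ℝ≥0) := by
    rw [WithTop.coe_lt_coe, ← NNReal.coe_lt_coe, Real.coe_toNNReal _ hT₀]
    linarith
  exact ⟨htT.trans_le hsol.le_swallowingTime, Loewner.map_eq_of_isSolution hF.continuous_arcDriving hsol htT⟩

include hA hγc hfr hF in
/-- **At the terminal time, points off `A` are still flowing and `g_S = E_A - c(S)` there**:
the flow stays `im E_A(z)`-away from the driving function (`im E_1 ≤ im E_u`), so the extension
criterion `Loewner.IsSolution.coe_lt_swallowingTime_of_le_norm_sub` applies, and the maximal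
solution agrees with the flow up to `S` by uniqueness and continuity. [cite: Lawler2005, §4.1 Thm. 4.6] -/
theorem lt_swallowingTime_and_map_eq_end {S : ℝ≥0} (hS : (S : ℝ) = a 1 / 2) {z : ℂ}
    (hz : z ∈ upperHalfPlaneSet \ A) :
    (S : WithTop ℝ≥0) < Loewner.swallowingTime (arcDriving a U) z ∧
      Loewner.map (arcDriving a U) S z = arcFlow E a U z S := by
  have hW := hF.continuous_arcDriving
  have hS0 : 0 < S := by
    rw [← NNReal.coe_pos, hS]; linarith [hF.clock_one_pos]
  have hz' : z ∈ upperHalfPlaneSet \ arcHullAt A γ 1 := by rwa [arcHullAt_one]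
  have hsol := isSolution_arcFlow hA hγc hfr hF ⟨zero_lt_one, le_rfl⟩ hz' hS
  -- the flow stays away from the driving function
  have hE1 : E 1 z ∈ upperHalfPlaneSet := (hF.bijOn 1 ⟨zero_lt_one, le_rfl⟩).mapsTo hz'
  have hδ : (0 : ℝ) < (E 1 z).im := hE1
  have hδ' : 0 < ((E 1 z).im).toNNReal := Real.toNNReal_pos.2 hδ
  have hfar : ∀ t : ℝ, 0 ≤ t → t < S → ((((E 1 z).im).toNNReal : ℝ≥0) : ℝ) ≤
      ‖arcFlow E a U z t - arcDriving a U t.toNNReal‖ := by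
    intro t ht0 htS
    dsimp only [arcDriving]
    rw [Real.coe_toNNReal _ ht0, Real.coe_toNNReal _ hδ.le]
    have hden : arcFlow E a U z t - arcDrivingR a U t = E (arcParam a t) z - U (arcParam a t) := by
      simp only [arcFlow, arcDrivingR, arcTip]; push_cast; ring
    rw [hden]
    refine le_trans ?_ (Complex.im_le_norm _)
    rw [sub_im, ofReal_im, sub_zero]
    exact hF.im_le _ (hF.arcParam_mem t) z hz
  have hlt := hsol.coe_lt_swallowingTime_of_le_norm_sub hW hS0 hδ' hfar
  refine ⟨hlt, ?_⟩
  -- the maximal solution and its value at `S`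
  obtain ⟨G, hG⟩ := Loewner.exists_isSolution_swallowingTime_holds hW (Loewner.ne_driving_of_lt_swallowingTime hlt)
  rw [Loewner.map_eq_of_isSolution hW hG hlt]
  -- `G = flow` on `[0, S)`
  have heq : ∀ t ∈ Ico (0 : ℝ) S, G t = arcFlow E a U z t := by
    intro t ht
    refine Loewner.IsSolution.eqOn_holds hW hG hsol ⟨ht.1, ?_⟩
    refine lt_min ?_ ?_
    · refine lt_of_lt_of_le ?_ hlt.le
      rw [WithTop.coe_lt_coe, ← NNReal.coe_lt_coe, Real.coe_toNNReal _ ht.1]; exact ht.2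
    · rw [WithTop.coe_lt_coe, ← NNReal.coe_lt_coe, Real.coe_toNNReal _ ht.1]; exact ht.2
  -- continuity of both at `S` from the left
  haveI : (𝓝[Ico (0 : ℝ) S] (S : ℝ)).NeBot := right_nhdsWithin_Ico_neBot (NNReal.coe_pos.2 hS0)
  have hSD : (S : ℝ) ∈ {t : ℝ | 0 ≤ t ∧ (t.toNNReal : WithTop ℝ≥0) < Loewner.swallowingTime (arcDriving a U) z} :=
    ⟨S.coe_nonneg, by rw [Real.toNNReal_coe]; exact hlt⟩
  have hIco : Ico (0 : ℝ) S ⊆ {t : ℝ | 0 ≤ t ∧ (t.toNNReal : WithTop ℝ≥0) < Loewner.swallowingTime (arcDriving a U) z} := by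
    intro t ht
    refine ⟨ht.1, lt_trans ?_ hlt⟩
    rw [WithTop.coe_lt_coe, ← NNReal.coe_lt_coe, Real.coe_toNNReal _ ht.1]; exact ht.2
  have hG' : Tendsto G (𝓝[Ico (0 : ℝ) S] (S : ℝ)) (𝓝 (G S)) :=
    ((hG.continuousOn _ hSD).mono hIco).tendsto
  have hh' : Tendsto (arcFlow E a U z) (𝓝[Ico (0 : ℝ) S] (S : ℝ)) (𝓝 (arcFlow E a U z S)) := by
    have hS' : (S : ℝ) ∈ Icc 0 (a 1 / 2) := ⟨S.coe_nonneg, hS.le⟩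
    have hc := (hasDerivWithinAt_arcFlow hA hγc hfr hF ⟨zero_lt_one, le_rfl⟩ hz' hS').continuousWithinAt
    rw [← hS] at hc
    exact (hc.mono Ico_subset_Icc_self).tendsto
  have hev : G =ᶠ[𝓝[Ico (0 : ℝ) S] (S : ℝ)] arcFlow E a U z :=
    eventually_mem_nhdsWithin.mono fun t ht ↦ heq t ht
  exact tendsto_nhds_unique (hG'.congr' hev) hh'

/-! #### The hulls of the chain -/

include hA hγc hγi hfr hF in
/-- **The Loewner hull before the terminal time is the slit**: `K_t = ℍ ∩ γ[0, σ t] = γ(0, σ t]`.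
[cite: LawlerSchrammWerner2003Restriction, proof of Lemma 3.5 (p. 13)] -/
theorem hull_eq_of_lt {t : ℝ≥0} (ht0 : 0 < t) (ht : (t : ℝ) < a 1 / 2) :
    Loewner.hull (arcDriving a U) t = upperHalfPlaneSet ∩ arcHullAt A γ (arcParam a t) := by
  have hW := hF.continuous_arcDriving
  set V : Set ℂ := upperHalfPlaneSet \ arcHullAt A γ (arcParam a t) with hV
  have hVdom : V ⊆ Loewner.domain (arcDriving a U) t := fun z hz ↦
    (Loewner.mem_domain_iff _ _ _).2 ⟨hz.1, (lt_swallowingTime_and_map_eq hA hγc hγi hfr hF ht hz).1⟩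
  have hσpos : 0 < arcParam a t := by
    rw [← hF.arcParam_zero]
    exact hF.strictMonoOn_arcParam ⟨le_rfl, by linarith [t.coe_nonneg]⟩ ⟨t.coe_nonneg, ht.le⟩ (NNReal.coe_pos.2 ht0)
  have hσmem : arcParam a t ∈ Ioc (0 : ℝ) 1 := ⟨hσpos, (hF.arcParam_mem t).2⟩
  have hsurj : SurjOn (Loewner.map (arcDriving a U) t) V upperHalfPlaneSet := by
    intro w hw
    have hwc : w + (arcTimeShift a U t : ℂ) ∈ upperHalfPlaneSet := by
      show 0 < (w + (arcTimeShift a U t : ℂ)).im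
      rw [add_im, ofReal_im, add_zero]; exact hw
    obtain ⟨z, hz, hzw⟩ := (hF.bijOn _ hσmem).surjOn hwc
    refine ⟨z, hz, ?_⟩
    rw [(lt_swallowingTime_and_map_eq hA hγc hγi hfr hF ht hz).2, arcFlow, hzw, add_sub_cancel_right]
  rw [Loewner.hull_eq_of_surjOn hW hVdom hsurj, hV, sdiff_sdiff_right_self]

include hA hγc hfr hF in
/-- **The Loewner hull at the terminal time is `A ∩ ℍ`**: the enclosed region is swallowed.
[cite: LawlerSchrammWerner2003Restriction, proof of Lemma 3.5 (p. 13), "Φ_s = Φ_{E_δ}"] -/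
theorem hull_end {S : ℝ≥0} (hS : (S : ℝ) = a 1 / 2) :
    Loewner.hull (arcDriving a U) S = A ∩ upperHalfPlaneSet := by
  have hW := hF.continuous_arcDriving
  set V : Set ℂ := upperHalfPlaneSet \ A with hV
  have hVdom : V ⊆ Loewner.domain (arcDriving a U) S := fun z hz ↦
    (Loewner.mem_domain_iff _ _ _).2 ⟨hz.1, (lt_swallowingTime_and_map_eq_end hA hγc hfr hF hS hz).1⟩
  have hsurj : SurjOn (Loewner.map (arcDriving a U) S) V upperHalfPlaneSet := by
    intro w hw
    have hwc : w + (arcTimeShift a U S : ℂ) ∈ upperHalfPlaneSet := by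
      show 0 < (w + (arcTimeShift a U S : ℂ)).im
      rw [add_im, ofReal_im, add_zero]; exact hw
    have hbij := hF.bijOn 1 ⟨zero_lt_one, le_rfl⟩
    rw [arcHullAt_one] at hbij
    obtain ⟨z, hz, hzw⟩ := hbij.surjOn hwc
    refine ⟨z, hz, ?_⟩
    rw [(lt_swallowingTime_and_map_eq_end hA hγc hfr hF hS hz).2, arcFlow]
    have h1 : arcParam a S = 1 := by
      rw [arcParam, hS, mul_div_cancel₀ _ two_ne_zero]
      exact clockInv_clock_one hF.strictMonoOn_clock hF.clock_zero
    rw [h1, hzw, add_sub_cancel_right]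
  rw [Loewner.hull_eq_of_surjOn hW hVdom hsurj, hV, sdiff_sdiff_right_self, inter_comm]

/-! #### The conclusion of `IsArcHull.exists_loewner_chain` -/

include hA hγc hγi h0 hH hfr hF in
/-- **From the flow to the chain**: the conclusion of the named fact
`IsArcHull.exists_loewner_chain` for `(A, γ)`, with the driving function `W = Ũ ∘ σ - c`, the
terminal time `S = a(1)/2` and the time change `σ = a⁻¹(2 ·)`.
[cite: LawlerSchrammWerner2003Restriction, proof of Lemma 3.5 (p. 13)] -/
theorem exists_chain :
    ∃ (W : ℝ≥0 → ℝ) (S : ℝ≥0) (σ : ℝ≥0 → ℝ), Continuous W ∧ 0 < S ∧ (W 0 : ℂ) = γ 0 ∧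
      ContinuousOn σ (Iic S) ∧ StrictMonoOn σ (Iic S) ∧ σ 0 = 0 ∧ σ S = 1 ∧
      (∀ t : ℝ≥0, t < S → Loewner.hull W t = γ '' (σ '' Ioc 0 t)) ∧
      Loewner.hull W S = A ∩ upperHalfPlaneSet := by
  have ha1 := hF.clock_one_pos
  set S : ℝ≥0 := ⟨a 1 / 2, by linarith⟩ with hSdef
  have hS : (S : ℝ) = a 1 / 2 := rfl
  have hS0 : 0 < S := by rw [← NNReal.coe_pos, hS]; linarith
  set σ : ℝ≥0 → ℝ := fun t ↦ arcParam a t with hσdef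
  have hIic : ∀ t : ℝ≥0, t ∈ Iic S → (t : ℝ) ∈ Icc 0 (a 1 / 2) := fun t ht ↦
    ⟨t.coe_nonneg, by rw [← hS]; exact_mod_cast ht⟩
  refine ⟨arcDriving a U, S, σ, hF.continuous_arcDriving, hS0, arcDriving_zero h0 hF, ?_, ?_,
    hF.arcParam_zero, ?_, fun t ht ↦ ?_, hull_end hA hγc hfr hF hS⟩
  · exact (hF.continuous_arcParam.comp continuous_subtype_val).continuousOn
  · intro t ht t' ht' hlt
    exact hF.strictMonoOn_arcParam (hIic t ht) (hIic t' ht') (NNReal.coe_lt_coe.2 hlt)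
  · show arcParam a S = 1
    rw [hS]; exact hF.arcParam_end
  · -- the hull at time `t < S`
    by_cases ht0' : t = 0
    swap
    · have ht0 : 0 < t := pos_iff_ne_zero.2 ht0'
      have ht' : (t : ℝ) < a 1 / 2 := by rw [← hS]; exact_mod_cast ht
      rw [hull_eq_of_lt hA hγc hγi hfr hF ht0 ht']
      have hσt1 : arcParam a t < 1 := by
        rw [← hF.arcParam_end]
        exact hF.strictMonoOn_arcParam ⟨t.coe_nonneg, ht'.le⟩ ⟨by linarith, le_rfl⟩ ht'
      have hσt0 : 0 < arcParam a t := by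
        rw [← hF.arcParam_zero]
        exact hF.strictMonoOn_arcParam ⟨le_rfl, by linarith⟩ ⟨t.coe_nonneg, ht'.le⟩ (NNReal.coe_pos.2 ht0)
      rw [arcHullAt_of_lt hσt1, inter_comm,
        slit_inter_upperHalfPlaneSet hσt0 h0 fun r hr ↦ hH r ⟨hr.1, hr.2.trans_lt hσt1⟩]
      -- `σ(Ioc 0 t) = Ioc 0 (σ t)`
      congr 1
      refine Subset.antisymm ?_ ?_
      · -- `Ioc 0 (σ t) ⊆ σ(Ioc 0 t)` by the intermediate value theorem
        have hc : ContinuousOn σ (Icc 0 t) := (hF.continuous_arcParam.comp continuous_subtype_val).continuousOn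
        have := intermediate_value_Ioc (show (0 : ℝ≥0) ≤ t by simp) hc
        rw [show σ 0 = 0 from hF.arcParam_zero] at this
        exact this
      · rintro _ ⟨s, hs, rfl⟩
        have hsI : (s : ℝ) ∈ Icc 0 (a 1 / 2) := ⟨s.coe_nonneg, (NNReal.coe_le_coe.2 hs.2).trans ht'.le⟩
        refine ⟨?_, ?_⟩
        · rw [← hF.arcParam_zero]
          exact hF.strictMonoOn_arcParam ⟨le_rfl, by linarith⟩ hsI (NNReal.coe_pos.2 hs.1)
        · exact hF.monotoneOn_arcParam hsI ⟨t.coe_nonneg, ht'.le⟩ (NNReal.coe_le_coe.2 hs.2)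
    · subst ht0'
      rw [Loewner.hull_zero_holds hF.continuous_arcDriving, Ioc_self, image_empty, image_empty]

end IsArcLoewnerFlow

/-- **The named fact `IsArcHull.exists_loewner_chain` follows from the existence of a flow**
`IsArcLoewnerFlow A γ E a U` for every arc hull `A ∈ 𝒬₊` with boundary path `γ` (the analytic
half of Loewner's slit theorem). [cite: LawlerSchrammWerner2003Restriction, proof of Lemma 3.5 (p. 13)] -/
theorem IsArcHull.exists_loewner_chain_of_flow
    (hflow : ∀ {A : Set ℂ}, IsArcHull A → IsPlusHull A →
      ∀ {γ : ℝ → ℂ}, ContinuousOn γ (Icc 0 1) → InjOn γ (Icc 0 1) → (γ 0).im = 0 → (γ 1).im = 0 →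
        (∀ t ∈ Ioo (0 : ℝ) 1, 0 < (γ t).im) → upperHalfPlaneSet ∩ frontier A = γ '' Ioo 0 1 →
        ∃ (E : ℝ → ℂ → ℂ) (a U : ℝ → ℝ), IsArcLoewnerFlow A γ E a U) :
    IsArcHull.exists_loewner_chain := by
  intro A hA hAp γ hγc hγi h0 h1 hH hfr
  obtain ⟨E, a, U, hF⟩ := hflow hA hAp hγc hγi h0 h1 hH hfr
  exact hF.exists_chain hA hγc hγi h0 hH hfr

end Assembly

end Literature.Probability.RandomPlanarGeometry
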